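import Literature.Analysis.FluidPDE.ChaeAsymptoticallySelfSimilarEnergySmallness
import Literature.Analysis.FluidPDE.ChaeAsymptoticallySelfSimilarProfile
import Literature.Analysis.FluidPDE.DistributionalL3Mild
import Literature.Analysis.FluidPDE.KatoLocalLerayPressureProofs
import Literature.Analysis.FluidPDE.MildL3SmoothHolds
import HarnessLib

/-!
# Chae 2007, Theorem 1.5: the profile conclusion `V̄ = 0` for `p = 3` (proofs companion, part 7)

Analysis/FluidPDE proofs file (theorems only: no definitions, no named facts), seventh companion
of `Literature/Analysis/FluidPDE/ChaeAsymptoticallySelfSimilar.lean` (D. Chae, Math. Ann. 338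
(2007) 435–449 = arXiv:math/0604234, **Theorem 1.5**, the named fact
`chae2007_asymptoticallySelfSimilar_local`). The sixth companion reduced the fact to two inputs,
`h₁` (regularity of very weak Leray profiles in `L^p`, `p ≥ 3`) and `h₂` (a suitable
representative up to the blow-up time). This file PROVES the profile conclusion `V̄ = 0` in the
critical case `p = 3` with no regularity input, along the parabolic route available in the tree:
the blow-up limit `u_V = lerayBackward ½ 0 V̄` is a very weak solution of Navier–Stokes on the
slab `(−1, 0) × ℝ³` (`integral_veryWeak_lerayBackward_eq_zero`, second companion) with slices
`(−t)^{-1/2}V̄(·/√(−t)) ∈ L³`, continuous in `L³` (dilations act continuously on `L³`); with the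
Riesz pressure (`exists_spaceTime_rieszPressure`) it is a distributional solution
(`isDistributionalNSSolutionOn_slab_of_veryWeak`), hence a mild solution in `C_t L³` from any of
its slices (`DistributionalL3Mild.isMildNSSolutionOn_translate_of_distributional`,
Fabes–Jones–Rivière), hence represented by a classical solution for later times
(`mild_L3_smooth_holds`, Giga / Kato), and the classical representative of a backward
self-similar field is Leray's field of a smooth `L³` profile, which vanishes by
Nečas–Růžička–Šverák (`profile_ae_eq_zero_of_classical_representative'`, a variant of the third
companion's endgame on a general final interval).

* `tendsto_eLpNorm_rescaleData_sub_three` — dilations `c ↦ c V(c ·)` act continuously on `L³`;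
* `continuousInLpOn_rescaleData_comp` — hence `s ↦ c(s) V(c(s) ·)` is a `C_t L³` family for a
  continuous positive `c`;
* `profile_ae_eq_zero_of_classical_representative'` — the endgame on an interval `(a, b)`,
  `b ≤ 0`;
* `chae2007_profile_ae_eq_zero_three` — **`V̄ = 0` for `p = 3`** under the hypotheses of
  Theorem 1.5;
* `chae2007_asymptoticallySelfSimilar_local_of_inputs_three` — the fact from `h₁` restricted to
  `p > 3` and `h₂`.

## References

* D. Chae, Math. Ann. 338 (2007) = arXiv:math/0604234, proof of Thm 1.5 (arXiv p. 8) [Chae2007].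
* E. B. Fabes, B. F. Jones, N. M. Rivière, Arch. Rational Mech. Anal. 45 (1972), Thm. 2.1
  [FabesJonesRiviere1972].
* Y. Giga, J. Differential Equations 62 (1986), Thm. 4 [Giga1986]; T. Kato, Math. Z. 187 (1984)
  [Kato1984].
* J. Nečas, M. Růžička, V. Šverák, Acta Math. 176 (1996), Thm 1 [NecasRuzickaSverak1996].
-/

noncomputable section

open _root_.MeasureTheory Set Function Filter Metric TopologicalSpace InnerProductSpace
open scoped NNReal ENNReal _root_.Topology RealInnerProductSpace Laplacian ContDiff

namespace Literature.Analysis.FluidPDE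

/-- Local notation for physical space `ℝ³ = EuclideanSpace ℝ (Fin 3)`. -/
local notation "ℝ³" => EuclideanSpace ℝ (Fin 3)

/-! ### Dilations act continuously on `L³` -/

section Dilation

/-- `rescaleData` is linear in the field: `c (V − W)(c ·) = c V(c ·) − c W(c ·)`. [folklore] -/
theorem rescaleData_sub (c : ℝ) (V W : ℝ³ → ℝ³) :
    rescaleData c (V - W) = rescaleData c V - rescaleData c W := by
  funext x
  simp [rescaleData, smul_sub]

/-- **Dilations of a continuous compactly supported field depend continuously on the scale in
`L³`**: `‖c g(c ·) − c₀ g(c₀ ·)‖_{L³} → 0` as `c → c₀ > 0` (dominated convergence: near `c₀` the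
fields are uniformly bounded and supported in a fixed ball). [folklore] -/
theorem tendsto_eLpNorm_rescaleData_sub_of_continuous {g : ℝ³ → ℝ³} (hg : Continuous g)
    (hgc : HasCompactSupport g) {c₀ : ℝ} (hc₀ : 0 < c₀) :
    Tendsto (fun c => eLpNorm (rescaleData c g - rescaleData c₀ g) 3 volume) (𝓝 c₀) (𝓝 0) := by
  obtain ⟨Cg, hCg⟩ := hg.bounded_above_of_compact_support hgc
  have hCg0 : 0 ≤ Cg := (norm_nonneg _).trans (hCg 0)
  obtain ⟨R, hR, hsupp⟩ : ∃ R : ℝ, 0 < R ∧ tsupport g ⊆ closedBall (0 : ℝ³) R := by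
    obtain ⟨R₀, hR₀⟩ := hgc.isCompact.isBounded.subset_closedBall (0 : ℝ³)
    exact ⟨max R₀ 1, by positivity, hR₀.trans (closedBall_subset_closedBall (le_max_left _ _))⟩
  have hg0 : ∀ x, R < ‖x‖ → g x = 0 := fun x hx =>
    image_eq_zero_of_notMem_tsupport fun h => (not_le.2 hx) (mem_closedBall_zero_iff.1 (hsupp h))
  -- the `L³` norm through the integral of the cube
  have hnorm : ∀ c, eLpNorm (rescaleData c g - rescaleData c₀ g) 3 volume =
      (∫⁻ x, ‖rescaleData c g x - rescaleData c₀ g x‖ₑ ^ (3 : ℝ)) ^ (1 / 3 : ℝ) := fun c => by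
    rw [eLpNorm_eq_lintegral_rpow_enorm_toReal (by norm_num) (by norm_num)]
    simp only [ENNReal.toReal_ofNat, one_div, Pi.sub_apply]
  simp only [hnorm]
  -- it suffices that the integrals tend to `0`
  suffices h : Tendsto (fun c => ∫⁻ x, ‖rescaleData c g x - rescaleData c₀ g x‖ₑ ^ (3 : ℝ)) (𝓝 c₀)
      (𝓝 0) by
    have := ((ENNReal.continuous_rpow_const (y := (1 / 3 : ℝ))).tendsto 0).comp h
    rwa [ENNReal.zero_rpow_of_pos (by norm_num)] at this
  -- dominated convergence on the window `c ∈ (c₀/2, 2c₀)`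
  set B : ℝ≥0∞ := ENNReal.ofReal ((2 * (2 * c₀) * Cg) ^ 3) with hB
  set bound : ℝ³ → ℝ≥0∞ := (closedBall (0 : ℝ³) (2 * R / c₀)).indicator fun _ => B with hbound
  have hwin : ∀ᶠ c in 𝓝 c₀, c ∈ Ioo (c₀ / 2) (2 * c₀) := Ioo_mem_nhds (by linarith) (by linarith)
  have hmeas : ∀ᶠ c in 𝓝 c₀, Measurable fun x => ‖rescaleData c g x - rescaleData c₀ g x‖ₑ ^ (3 : ℝ) := by
    refine Eventually.of_forall fun c => ?_
    have h1 : Continuous (rescaleData c g) := (hg.comp (continuous_const_smul c)).const_smul c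
    have h2 : Continuous (rescaleData c₀ g) := (hg.comp (continuous_const_smul c₀)).const_smul c₀
    exact ((h1.sub h2).measurable.enorm.pow_const _)
  have hfin : ∫⁻ x, bound x ≠ ⊤ := by
    rw [hbound, lintegral_indicator measurableSet_closedBall, setLIntegral_const]
    exact ENNReal.mul_ne_top ENNReal.ofReal_ne_top measure_closedBall_lt_top.ne
  have hlim : ∀ᵐ x ∂(volume : Measure ℝ³), Tendsto (fun c : ℝ => ‖rescaleData c g x - rescaleData c₀ g x‖ₑ ^ (3 : ℝ))
      (𝓝 c₀) (𝓝 ((fun _ : ℝ³ => (0 : ℝ≥0∞)) x)) := by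
    refine Eventually.of_forall fun x => ?_
    have hcont : Continuous fun c : ℝ => rescaleData c g x := by
      simp only [rescaleData]
      exact continuous_id.smul (hg.comp (continuous_id.smul continuous_const))
    have h1 : Tendsto (fun c : ℝ => rescaleData c g x - rescaleData c₀ g x) (𝓝 c₀) (𝓝 0) := by
      have hc2 : Continuous fun c : ℝ => rescaleData c g x - rescaleData c₀ g x :=
        hcont.sub continuous_const
      have := hc2.tendsto c₀
      simp only [sub_self] at this
      exact this
    have h2 : Tendsto (fun c : ℝ => ‖rescaleData c g x - rescaleData c₀ g x‖ₑ) (𝓝 c₀) (𝓝 0) := by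
      have := h1.enorm
      rwa [enorm_zero] at this
    have h3 := ((ENNReal.continuous_rpow_const (y := (3 : ℝ))).tendsto 0).comp h2
    rwa [ENNReal.zero_rpow_of_pos (by norm_num)] at h3
  have hdom : ∀ᶠ c in 𝓝 c₀, ∀ᵐ x ∂(volume : Measure ℝ³),
      ‖rescaleData c g x - rescaleData c₀ g x‖ₑ ^ (3 : ℝ) ≤ bound x := by
    filter_upwards [hwin] with c hc
    refine Eventually.of_forall fun x => ?_
    have hcpos : 0 < c := by linarith [hc.1]
    by_cases hx : x ∈ closedBall (0 : ℝ³) (2 * R / c₀)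
    · rw [hbound, indicator_of_mem hx, hB]
      have hpt : ‖rescaleData c g x - rescaleData c₀ g x‖ ≤ 2 * (2 * c₀) * Cg := by
        calc ‖rescaleData c g x - rescaleData c₀ g x‖
            ≤ ‖rescaleData c g x‖ + ‖rescaleData c₀ g x‖ := norm_sub_le _ _
          _ ≤ (2 * c₀) * Cg + (2 * c₀) * Cg := by
              refine add_le_add ?_ ?_
              · rw [rescaleData, norm_smul, Real.norm_of_nonneg hcpos.le]
                exact mul_le_mul hc.2.le (hCg _) (norm_nonneg _) (by linarith)
              · rw [rescaleData, norm_smul, Real.norm_of_nonneg hc₀.le]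
                exact mul_le_mul (by linarith) (hCg _) (norm_nonneg _) (by linarith)
          _ = 2 * (2 * c₀) * Cg := by ring
      calc ‖rescaleData c g x - rescaleData c₀ g x‖ₑ ^ (3 : ℝ)
          = ENNReal.ofReal (‖rescaleData c g x - rescaleData c₀ g x‖ ^ (3 : ℝ)) := by
            rw [← ofReal_norm, ENNReal.ofReal_rpow_of_nonneg (norm_nonneg _) (by norm_num)]
        _ ≤ ENNReal.ofReal ((2 * (2 * c₀) * Cg) ^ 3) := by
            refine ENNReal.ofReal_le_ofReal ?_
            have e : ‖rescaleData c g x - rescaleData c₀ g x‖ ^ (3 : ℝ) =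
                ‖rescaleData c g x - rescaleData c₀ g x‖ ^ 3 := by
              exact_mod_cast Real.rpow_natCast _ 3
            rw [e]
            exact pow_le_pow_left₀ (norm_nonneg _) hpt 3
    · -- off the big ball both fields vanish
      have hxR : 2 * R / c₀ < ‖x‖ := not_le.1 fun h => hx (mem_closedBall_zero_iff.2 h)
      have v1 : g (c • x) = 0 := by
        refine hg0 _ ?_
        rw [norm_smul, Real.norm_of_nonneg hcpos.le]
        have : R < c₀ / 2 * ‖x‖ := by
          rw [div_lt_iff₀ hc₀] at hxR
          nlinarith
        nlinarith [hc.1, norm_nonneg x]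
      have v2 : g (c₀ • x) = 0 := by
        refine hg0 _ ?_
        rw [norm_smul, Real.norm_of_nonneg hc₀.le]
        rw [div_lt_iff₀ hc₀] at hxR
        nlinarith [norm_nonneg x]
      rw [hbound, indicator_of_notMem hx]
      simp [rescaleData, v1, v2]
  have key := tendsto_lintegral_filter_of_dominated_convergence bound hmeas hdom hfin hlim
  rwa [lintegral_zero] at key

/-- **Dilations act continuously on `L³(ℝ³)`**: for `V ∈ L³` and `c₀ > 0`,
`‖c V(c ·) − c₀ V(c₀ ·)‖_{L³} → 0` as `c → c₀` (density of continuous compactly supported fields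
and the scale invariance `‖c W(c ·)‖_{L³} = ‖W‖_{L³}`, `eLpNorm_three_rescaleData`). [folklore] -/
theorem tendsto_eLpNorm_rescaleData_sub_three {V : ℝ³ → ℝ³} (hV : MemLp V 3 volume) {c₀ : ℝ}
    (hc₀ : 0 < c₀) :
    Tendsto (fun c => eLpNorm (rescaleData c V - rescaleData c₀ V) 3 volume) (𝓝 c₀) (𝓝 0) := by
  rw [ENNReal.tendsto_nhds_zero]
  intro ε hε
  have hε3 : ε / 3 ≠ 0 := (ENNReal.div_pos hε.ne' (by norm_num)).ne'
  obtain ⟨g, hgc, hgε, hg, hg3⟩ := hV.exists_hasCompactSupport_eLpNorm_sub_le (by norm_num) hε3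
  have hmid := tendsto_eLpNorm_rescaleData_sub_of_continuous hg hgc hc₀
  rw [ENNReal.tendsto_nhds_zero] at hmid
  have hpos : ∀ᶠ c in 𝓝 c₀, 0 < c := lt_mem_nhds hc₀
  filter_upwards [hmid (ε / 3) (ENNReal.div_pos hε.ne' (by norm_num)), hpos] with c hc hcpos
  have hVg : MemLp (V - g) 3 volume := hV.sub hg3
  have m1 : ∀ {b : ℝ}, 0 < b → AEStronglyMeasurable (rescaleData b (V - g)) volume := fun hb =>
    (memLp_three_rescaleData hVg hb).1
  have m2 : ∀ {b : ℝ}, 0 < b → AEStronglyMeasurable (rescaleData b g) volume := fun hb =>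
    (memLp_three_rescaleData hg3 hb).1
  -- the three-`ε/3` decomposition
  have e : rescaleData c V - rescaleData c₀ V =
      (rescaleData c (V - g) + (rescaleData c g - rescaleData c₀ g)) - rescaleData c₀ (V - g) := by
    rw [rescaleData_sub, rescaleData_sub]; abel
  rw [e]
  calc eLpNorm ((rescaleData c (V - g) + (rescaleData c g - rescaleData c₀ g)) -
        rescaleData c₀ (V - g)) 3 volume
      ≤ eLpNorm (rescaleData c (V - g) + (rescaleData c g - rescaleData c₀ g)) 3 volume +
          eLpNorm (rescaleData c₀ (V - g)) 3 volume :=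
        eLpNorm_sub_le ((m1 hcpos).add ((m2 hcpos).sub (m2 hc₀))) (m1 hc₀) (by norm_num)
    _ ≤ (eLpNorm (rescaleData c (V - g)) 3 volume +
          eLpNorm (rescaleData c g - rescaleData c₀ g) 3 volume) +
          eLpNorm (rescaleData c₀ (V - g)) 3 volume := by
        gcongr
        exact eLpNorm_add_le (m1 hcpos) ((m2 hcpos).sub (m2 hc₀)) (by norm_num)
    _ ≤ (ε / 3 + ε / 3) + ε / 3 := by
        rw [eLpNorm_three_rescaleData _ hcpos, eLpNorm_three_rescaleData _ hc₀]
        exact add_le_add (add_le_add hgε hc) hgε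
    _ = ε := ENNReal.add_thirds ε

/-- **A `C_t L³` family of dilated fields**: if `c` is continuous and positive on an open time
set `S` and `V ∈ L³`, then `s ↦ c(s) V(c(s) ·)` is in `C(S; L³)` (`ContinuousInLpOn`): the
slices are in `L³` by scale invariance and depend continuously on `s` by
`tendsto_eLpNorm_rescaleData_sub_three`. [folklore] -/
theorem continuousInLpOn_rescaleData_comp {V : ℝ³ → ℝ³} (hV : MemLp V 3 volume) {c : ℝ → ℝ}
    {S : Set ℝ} (hS : IsOpen S) (hc : ContinuousOn c S) (hcpos : ∀ s ∈ S, 0 < c s) :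
    ContinuousInLpOn S 3 (fun s => rescaleData (c s) V) := by
  refine ⟨fun s hs => memLp_three_rescaleData hV (hcpos s hs), fun s₀ hs₀ => ?_⟩
  have hcs : Tendsto c (𝓝[S] s₀) (𝓝 (c s₀)) := by
    have := (hc.continuousAt (hS.mem_nhds hs₀)).tendsto
    exact this.mono_left nhdsWithin_le_nhds
  have h := (tendsto_eLpNorm_rescaleData_sub_three hV (hcpos s₀ hs₀)).comp hcs
  exact h

end Dilation

/-! ### The backward self-similar field as a `C_t L³` family on the slab `(0, 1) × ℝ³` -/

section BackwardField

variable {V : ℝ³ → ℝ³}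

/-- The scale factor of Chae's backward field shifted to blow up at `s = 1`:
`c(s) = (√(1 − s))⁻¹`, positive and continuous on `s < 1`. [cite: Chae2007, (3.13) (arXiv p. 8)] -/
theorem continuousOn_inv_sqrt_one_sub :
    ContinuousOn (fun s : ℝ => (Real.sqrt (1 - s))⁻¹) (Iio 1) := by
  refine ContinuousOn.inv₀ ((Real.continuous_sqrt.comp (continuous_const.sub continuous_id)).continuousOn)
    fun s hs => ?_
  exact (Real.sqrt_pos.2 (sub_pos.2 hs)).ne'

/-- **The shifted backward field is a dilation family**: for every `s`,
`lerayBackward ½ 0 V (s − 1) = (√(1−s))⁻¹ V((√(1−s))⁻¹ ·) = rescaleData (√(1−s))⁻¹ V`.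
[cite: Chae2007, (3.13) (arXiv p. 8)] -/
theorem lerayBackward_half_zero_sub_one (V : ℝ³ → ℝ³) (s : ℝ) :
    lerayBackward (1 / 2) 0 V (s - 1) = rescaleData (Real.sqrt (1 - s))⁻¹ V := by
  funext x
  rw [lerayBackward_half_zero_apply, rescaleData]
  rw [show -(s - 1) = 1 - s by ring]

/-- **The shifted backward field `w(s) = u_V(s − 1)` is in `C((−∞, 1); L³)`** for `V ∈ L³`.
[folklore] -/
theorem continuousInLpOn_lerayBackward_shift (hV : MemLp V 3 volume) {S : Set ℝ} (hS : S ⊆ Iio 1) :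
    ContinuousInLpOn S 3 (fun s => lerayBackward (1 / 2) 0 V (s - 1)) := by
  have h := continuousInLpOn_rescaleData_comp hV isOpen_Iio continuousOn_inv_sqrt_one_sub
    (fun s hs => inv_pos.2 (Real.sqrt_pos.2 (sub_pos.2 hs)))
  have h' : ContinuousInLpOn S 3 (fun s => rescaleData (Real.sqrt (1 - s))⁻¹ V) := h.mono hS
  simpa only [lerayBackward_half_zero_sub_one] using h'

/-- The `L³` norm of every slice of the shifted backward field before the blow-up time is
`‖V‖_{L³}`. [folklore] -/
theorem eLpNorm_lerayBackward_shift (V : ℝ³ → ℝ³) {s : ℝ} (hs : s < 1) :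
    eLpNorm (lerayBackward (1 / 2) 0 V (s - 1)) 3 volume = eLpNorm V 3 volume := by
  rw [lerayBackward_half_zero_sub_one]
  exact eLpNorm_three_rescaleData V (inv_pos.2 (Real.sqrt_pos.2 (sub_pos.2 hs)))

/-- **Joint measurability of the shifted backward field** for a (strongly) measurable profile:
`(s, x) ↦ u_V(s − 1, x) = c(s) V(c(s) x)` is strongly measurable on `ℝ × ℝ³`. [folklore] -/
theorem stronglyMeasurable_uncurry_lerayBackward_shift (hV : StronglyMeasurable V) :
    StronglyMeasurable (uncurry fun s x => lerayBackward (1 / 2) 0 V (s - 1) x) := by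
  have hc : Measurable fun s : ℝ => (Real.sqrt (1 - s))⁻¹ :=
    (Real.continuous_sqrt.measurable.comp (measurable_const.sub measurable_id)).inv
  have hm : Measurable fun z : ℝ × ℝ³ => (Real.sqrt (1 - z.1))⁻¹ • z.2 :=
    (hc.comp measurable_fst).smul measurable_snd
  have h1 : StronglyMeasurable fun z : ℝ × ℝ³ => V ((Real.sqrt (1 - z.1))⁻¹ • z.2) :=
    hV.comp_measurable hm
  have h2 : StronglyMeasurable fun z : ℝ × ℝ³ =>
      (Real.sqrt (1 - z.1))⁻¹ • V ((Real.sqrt (1 - z.1))⁻¹ • z.2) :=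
    ((hc.comp measurable_fst).stronglyMeasurable).smul h1
  have e : (uncurry fun s x => lerayBackward (1 / 2) 0 V (s - 1) x) =
      fun z : ℝ × ℝ³ => (Real.sqrt (1 - z.1))⁻¹ • V ((Real.sqrt (1 - z.1))⁻¹ • z.2) := by
    funext z
    simp only [uncurry, lerayBackward_half_zero_sub_one, rescaleData]
  rw [e]
  exact h2

/-- **The shifted backward field lies in `L³` of every slab `(0, S) × ℝ³`, `S ≤ 1`**, with
`∫₀ˢ‖u_V(s−1)‖³_{L³} ds = S ‖V‖³_{L³}`. [folklore] -/
theorem memLp_uncurry_lerayBackward_shift (hV : MemLp V 3 volume) (hVm : StronglyMeasurable V)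
    {S : ℝ} (hS1 : S ≤ 1) :
    MemLp (uncurry fun s x => lerayBackward (1 / 2) 0 V (s - 1) x) 3
      (volume.restrict (Ioo 0 S ×ˢ (univ : Set ℝ³))) := by
  have hsm := stronglyMeasurable_uncurry_lerayBackward_shift hVm
  refine ⟨hsm.aestronglyMeasurable, ?_⟩
  rw [eLpNorm_eq_lintegral_rpow_enorm_toReal (by norm_num) (by norm_num), ENNReal.toReal_ofNat]
  refine ENNReal.rpow_lt_top_of_nonneg (by norm_num) (ne_of_lt ?_)
  have hmeas : AEMeasurable (fun z : ℝ × ℝ³ =>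
      ‖uncurry (fun s x => lerayBackward (1 / 2) 0 V (s - 1) x) z‖ₑ ^ (3 : ℝ))
      ((volume.restrict (Ioo 0 S)).prod (volume : Measure ℝ³)) :=
    (hsm.measurable.enorm.pow_const _).aemeasurable
  rw [volume_restrict_prod_univ_eq_prod, lintegral_prod _ hmeas]
  calc ∫⁻ s in Ioo 0 S, ∫⁻ x, ‖uncurry (fun s x => lerayBackward (1 / 2) 0 V (s - 1) x) (s, x)‖ₑ ^ (3 : ℝ)
      ≤ ∫⁻ _ in Ioo 0 S, eLpNorm V 3 volume ^ (3 : ℝ) := by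
        refine lintegral_mono_ae ?_
        filter_upwards [ae_restrict_mem measurableSet_Ioo] with s hs
        have e := eLpNorm_eq_lintegral_rpow_enorm_toReal (f := lerayBackward (1 / 2) 0 V (s - 1))
          (p := 3) (μ := volume) (by norm_num) (by norm_num)
        simp only [ENNReal.toReal_ofNat] at e
        have h1 : (∫⁻ x, ‖lerayBackward (1 / 2) 0 V (s - 1) x‖ₑ ^ (3 : ℝ)) =
            eLpNorm (lerayBackward (1 / 2) 0 V (s - 1)) 3 volume ^ (3 : ℝ) := by
          rw [e, ← ENNReal.rpow_mul]; norm_num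
        simp only [uncurry]
        rw [h1, eLpNorm_lerayBackward_shift V (hs.2.trans_le hS1)]
    _ < ⊤ := by
        rw [lintegral_const, Measure.restrict_apply_univ, Real.volume_Ioo]
        exact ENNReal.mul_lt_top (ENNReal.rpow_lt_top_of_nonneg (by norm_num) hV.2.ne)
          ENNReal.ofReal_lt_top

end BackwardField


/-! ### The shifted blow-up limit is a distributional, then mild, then classical solution -/

section Chain

variable {T : ℝ} {z : ℝ³} {q : ℝ≥0} {v : ℝ → ℝ³ → ℝ³} {π : ℝ → ℝ³ → ℝ} {V : ℝ³ → ℝ³}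

/-- Slabs with equal time sets are equal. [folklore] -/
theorem slab_Ioo_zero_sub_one_eq :
    (slab ℝ³ (Ioo ((0 : ℝ) - 1) (1 - 1)) isOpen_Ioo : Opens (ℝ × ℝ³)) = slab ℝ³ (Ioo (-1) 0) isOpen_Ioo := by
  ext w
  change w ∈ Ioo ((0 : ℝ) - 1) (1 - 1) ×ˢ (univ : Set ℝ³) ↔ w ∈ Ioo (-1 : ℝ) 0 ×ˢ (univ : Set ℝ³)
  norm_num

/-- **The very weak identity on the shifted slab.** Under the hypotheses of Theorem 1.5 in normal
form (the deviation tends to `0` for every `R`, `q ≥ 2`), the shifted blow-up limit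
`w(s) = u_V(s − 1)` satisfies the very weak (divergence-free tested, pressure-free) Navier–Stokes
identity on the slab `(0, 1) × ℝ³` (the second companion's
`integral_veryWeak_lerayBackward_eq_zero`, translated in time). [cite: Chae2007, proof of Thm 1.5 (arXiv p. 8)] -/
theorem integral_veryWeak_shift_eq_zero (hT : 0 < T)
    (hv : IsClassicalNSSolutionOn (Ioo 0 T) 1 0 v π) (hVm : AEStronglyMeasurable V volume)
    (hq : 2 ≤ q)
    (hdev : ∀ R : ℝ, 0 < R → Tendsto (chaeLocalDeviation T z q R v V) (𝓝[<] T) (𝓝 0))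
    {ψ : ℝ → ℝ³ → ℝ³} (hψ : IsSpaceTimeTestOn (slab ℝ³ (Ioo 0 1) isOpen_Ioo) ψ)
    (hdivψ : ∀ t, VectorCalculus.IsDivFree (ψ t)) :
    ∫ s in Ioo (0 : ℝ) 1, ∫ x, (⟪lerayBackward (1 / 2) 0 V (s - 1) x, timeDeriv ψ s x⟫ +
      ⟪lerayBackward (1 / 2) 0 V (s - 1) x,
        convect (lerayBackward (1 / 2) 0 V (s - 1)) (ψ s) x⟫ +
      1 * ⟪lerayBackward (1 / 2) 0 V (s - 1) x, Δ (ψ s) x⟫) = 0 := by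
  set u : ℝ → ℝ³ → ℝ³ := lerayBackward (1 / 2) 0 V with hu
  set J : ℝ → ℝ := fun s => ∫ x, (⟪u (s - 1) x, timeDeriv ψ s x⟫ +
      ⟪u (s - 1) x, convect (u (s - 1)) (ψ s) x⟫ + 1 * ⟪u (s - 1) x, Δ (ψ s) x⟫) with hJ
  change ∫ s in Ioo (0 : ℝ) 1, J s = 0
  -- the translated test field on the slab `(-1, 0)`
  set ψ' : ℝ → ℝ³ → ℝ³ := fun t x => ψ (t + 1) x with hψ'def
  have hψ' : IsSpaceTimeTestOn (slab ℝ³ (Ioo (-1) 0) isOpen_Ioo) ψ' := by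
    have h := hψ.comp_add_time (s := 1)
    rw [slab_Ioo_zero_sub_one_eq] at h
    exact h
  have hdiv' : ∀ t, VectorCalculus.IsDivFree (ψ' t) := fun t => hdivψ (t + 1)
  have key := integral_veryWeak_lerayBackward_eq_zero hT hv hVm hq hdev hψ' hdiv'
  -- its integrand is `J (t + 1)`
  have hint : ∀ t, (∫ x, (⟪u t x, timeDeriv ψ' t x⟫ + ⟪u t x, convect (u t) (ψ' t) x⟫ +
      1 * ⟪u t x, Δ (ψ' t) x⟫)) = J (t + 1) := by
    intro t
    simp only [hJ, hψ'def, add_sub_cancel_right, timeDeriv_comp_add_time]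
  have key' : ∫ t in Ioo (-1 : ℝ) 0, J (t + 1) = 0 :=
    (setIntegral_congr_fun measurableSet_Ioo fun t _ => (hint t).symm).trans key
  -- change of variables `s = t + 1`
  have e : ∫ t in Ioo (-1 : ℝ) 0, J (t + 1) = ∫ s in Ioo (0 : ℝ) 1, J s := by
    rw [← integral_Ioc_eq_integral_Ioo, ← intervalIntegral.integral_of_le (by norm_num),
      intervalIntegral.integral_comp_add_right J 1, ← integral_Ioc_eq_integral_Ioo,
      ← intervalIntegral.integral_of_le (by norm_num)]
    norm_num
  rw [← e, key']

/-- **Weak divergence-freeness of the shifted slices**: `w(s) = u_V(s − 1)` is weakly divergence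
free for `s < 1`... more precisely for `s ∈ (0, 1)` (second companion,
`isWeaklyDivFree_lerayBackward_slice`). [cite: Chae2007, proof of Thm 1.5 (arXiv p. 8)] -/
theorem isWeaklyDivFree_shift (hT : 0 < T)
    (hv : IsClassicalNSSolutionOn (Ioo 0 T) 1 0 v π) (hVm : AEStronglyMeasurable V volume)
    (hq : 2 ≤ q)
    (hdev : ∀ R : ℝ, 0 < R → Tendsto (chaeLocalDeviation T z q R v V) (𝓝[<] T) (𝓝 0))
    {s : ℝ} (hs : s ∈ Ioo (0 : ℝ) 1) : IsWeaklyDivFree (lerayBackward (1 / 2) 0 V (s - 1)) :=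
  isWeaklyDivFree_lerayBackward_slice hT hv hVm (le_trans (by norm_num) hq) hdev
    ⟨by linarith [hs.1], by linarith [hs.2]⟩

/-- **The shifted blow-up limit is a distributional solution with the Riesz pressure** on every
slab `(0, S) × ℝ³`, `0 < S < 1` (very weak identity + `L³` class + continuity in `L³` ⇒ the
space–time Riesz pressure of `exists_spaceTime_rieszPressure` and
`isDistributionalNSSolutionOn_slab_of_veryWeak`), the pressure lying in `L^{3/2}` of the slab.
[cite: Chae2007, proof of Thm 1.5 (arXiv p. 8); LemarieRieusset2016, Prop. 6.5] -/
theorem exists_distributional_shift (hT : 0 < T)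
    (hv : IsClassicalNSSolutionOn (Ioo 0 T) 1 0 v π) (hV : MemLp V 3 volume)
    (hVm : StronglyMeasurable V) (hq : 2 ≤ q)
    (hdev : ∀ R : ℝ, 0 < R → Tendsto (chaeLocalDeviation T z q R v V) (𝓝[<] T) (𝓝 0))
    {S : ℝ} (hS : 0 < S) (hS1 : S < 1) :
    ∃ P : ℝ → ℝ³ → ℝ,
      IsDistributionalNSSolutionOn (slab ℝ³ (Ioo 0 S) isOpen_Ioo) 1 0
        (fun s => lerayBackward (1 / 2) 0 V (s - 1)) P ∧
      MemLp (uncurry P) (3 / 2) (volume.restrict (Ioo 0 S ×ˢ (univ : Set ℝ³))) := by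
  set w : ℝ → ℝ³ → ℝ³ := fun s => lerayBackward (1 / 2) 0 V (s - 1) with hw
  have hu3 : MemLp (uncurry w) 3 (volume.restrict (Ioo 0 S ×ˢ (univ : Set ℝ³))) :=
    memLp_uncurry_lerayBackward_shift hV hVm hS1.le
  have hcont : ContinuousInLpOn (Icc 0 S) 3 w :=
    continuousInLpOn_lerayBackward_shift hV fun s hs => lt_of_le_of_lt hs.2 hS1
  obtain ⟨p, -, hp32, hsl⟩ := exists_spaceTime_rieszPressure hS hcont
  have hu1 : LocallyIntegrableOn (uncurry w)
      ((slab ℝ³ (Ioo 0 S) isOpen_Ioo : Opens (ℝ × ℝ³)) : Set (ℝ × ℝ³)) volume :=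
    locallyIntegrableOn_slab_of_memLp hu3 (by norm_num)
  have h32 : (1 : ℝ≥0∞) ≤ 3 / 2 :=
    ((ENNReal.lt_div_iff_mul_lt (Or.inl (by norm_num)) (Or.inl (by norm_num))).2 (by norm_num)).le
  have hu2 : LocallyIntegrableOn (fun z => ‖uncurry w z‖ ^ 2)
      ((slab ℝ³ (Ioo 0 S) isOpen_Ioo : Opens (ℝ × ℝ³)) : Set (ℝ × ℝ³)) volume :=
    locallyIntegrableOn_slab_of_memLp (memLp_norm_sq_of_memLp_three hu3) h32
  have hp1 : LocallyIntegrableOn (uncurry p)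
      ((slab ℝ³ (Ioo 0 S) isOpen_Ioo : Opens (ℝ × ℝ³)) : Set (ℝ × ℝ³)) volume :=
    locallyIntegrableOn_slab_of_memLp hp32 h32
  have hsl' : ∀ᵐ t ∂(volume.restrict (Ioo 0 S)), ∀ φ : ℝ³ → ℝ, ContDiff ℝ (⊤ : ℕ∞) φ →
      HasCompactSupport φ → ∫ x, p t x * (Δ φ) x = -∫ x, fderiv ℝ (fderiv ℝ φ) x (w t x) (w t x) := by
    filter_upwards [hsl] with t ht using ht.2.2.2
  refine ⟨p, ?_, hp32⟩
  refine isDistributionalNSSolutionOn_slab_of_veryWeak hu3 hp32 (fun θ hθ => ?_) (fun θ hθ => ?_)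
    (fun ψ hψ hdivψ => ?_)
  · -- weak divergence-freeness on the slab: slices and Fubini
    obtain ⟨hwc, -, hw0⟩ := hθ.continuous_gradient_field
    have hKQ : tsupport (uncurry θ) ⊆ ((slab ℝ³ (Ioo 0 S) isOpen_Ioo : Opens (ℝ × ℝ³)) : Set (ℝ × ℝ³)) :=
      hθ.tsupport_subset
    have hI : Integrable (fun ζ : ℝ × ℝ³ => ⟪w ζ.1 ζ.2, gradient (θ ζ.1) ζ.2⟫)
        (volume : Measure (ℝ × ℝ³)) :=
      integrable_inner_of_locallyIntegrableOn (Q := slab ℝ³ (Ioo 0 S) isOpen_Ioo)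
        hu1 hwc hθ.hasCompactSupport hKQ hw0
    have hvan : ∀ ζ : ℝ × ℝ³, ζ ∉ Ioo 0 S ×ˢ (univ : Set ℝ³) →
        ⟪w ζ.1 ζ.2, gradient (θ ζ.1) ζ.2⟫ = 0 := fun ζ hζ => by
      rw [hw0 ζ fun h => hζ (hKQ h), inner_zero_right]
    rw [setIntegral_eq_integral_of_forall_compl_eq_zero hvan,
      show (volume : Measure (ℝ × ℝ³)) = (volume : Measure ℝ).prod (volume : Measure ℝ³) from rfl,
      integral_prod _ hI]
    have hslice : ∀ t, ∫ x, ⟪w t x, gradient (θ t) x⟫ = 0 := by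
      intro t
      by_cases ht : t ∈ Ioo 0 S
      · exact isWeaklyDivFree_shift hT hv hV.1 hq hdev ⟨ht.1, ht.2.trans hS1⟩ (θ t)
          ((hθ.mono le_top).isTestFunctionOn_slice t)
      · refine integral_eq_zero_of_ae (Eventually.of_forall fun x => ?_)
        have hζ : ((t, x) : ℝ × ℝ³) ∉ tsupport (uncurry θ) := fun h => ht (mem_slab.1 (hKQ h))
        simp only [hw0 (t, x) hζ, inner_zero_right, Pi.zero_apply]
    simp only [hslice, integral_zero]
  · exact setIntegral_pressure_laplacian_eq_of_ae_slice hu1 hu2 hp1 hsl' hθ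
  · refine setIntegral_veryWeak_eq_zero_of_iterated hu1 hu2 hψ ?_
    -- the iterated identity on `(0, 1)` restricts to `(0, S)`: the integrand has time support there
    have hψ1 : IsSpaceTimeTestOn (slab ℝ³ (Ioo 0 1) isOpen_Ioo) ψ :=
      hψ.mono (slab_mono (Ioo_subset_Ioo le_rfl hS1.le))
    have key := integral_veryWeak_shift_eq_zero hT hv hV.1 hq hdev hψ1 hdivψ
    obtain ⟨a, b, h0a, hab, hbS, hsupp⟩ := hψ.exists_time_support_Ioo hS
    set J : ℝ → ℝ := fun s => ∫ x, (⟪w s x, timeDeriv ψ s x⟫ + ⟪w s x, convect (w s) (ψ s) x⟫ +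
      1 * ⟪w s x, Δ (ψ s) x⟫) with hJ
    have hψ0 : ∀ t, t ∉ Icc a b → ∀ x, ψ t x = 0 := fun t ht x => by rw [hsupp t ht]; rfl
    have hJ0 : ∀ t, t ∉ Icc a b → J t = 0 := by
      intro t ht
      refine integral_eq_zero_of_ae (Eventually.of_forall fun x => ?_)
      have hopen : IsOpen (Icc a b)ᶜ := isClosed_Icc.isOpen_compl
      have hnear : (fun s => ψ s x) =ᶠ[𝓝 t] fun _ => (0 : ℝ³) :=
        Filter.eventually_of_mem (hopen.mem_nhds ht) fun s hs => hψ0 s hs x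
      have h1 : timeDeriv ψ t x = 0 := by
        rw [timeDeriv_apply, hnear.deriv_eq, deriv_const]
      have h2 : fderiv ℝ (ψ t) x = 0 := by
        rw [show ψ t = fun _ => (0 : ℝ³) from funext (hψ0 t ht), fderiv_fun_const, Pi.zero_apply]
      have h3 : Δ (ψ t) x = 0 :=
        laplacian_eq_zero_of_notMem_tsupport (by
          rw [hsupp t ht, tsupport_eq_empty_iff.2 rfl]; exact notMem_empty x)
      dsimp only
      rw [Pi.zero_apply, h1, convect_apply, h2, h3]
      simp
    have eS : ∫ s in Ioo (0 : ℝ) S, J s = ∫ s, J s :=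
      setIntegral_eq_integral_of_forall_compl_eq_zero fun t ht =>
        hJ0 t fun h => ht ⟨h0a.trans_le h.1, h.2.trans_lt hbS⟩
    have e1 : ∫ s in Ioo (0 : ℝ) 1, J s = ∫ s, J s :=
      setIntegral_eq_integral_of_forall_compl_eq_zero fun t ht =>
        hJ0 t fun h => ht ⟨h0a.trans_le h.1, (h.2.trans_lt hbS).trans hS1⟩
    change ∫ s in Ioo (0 : ℝ) S, J s = 0
    rw [eS, ← e1]
    exact key

/-- **A classical representative of the blow-up limit on a final interval.** Under the hypotheses
of Theorem 1.5 in normal form with `V̄ ∈ L³` strongly measurable, there are `a < b ≤ 0` and a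
classical solution `(W, Π)` of Navier–Stokes (`ν = 1`, `f = 0`) on `(a, b)` with
`W(t) = u_V(t)` a.e. for every `t ∈ (a, b)`: the shifted limit is distributional on
`(0, ½) × ℝ³` (`exists_distributional_shift`), hence mild in `C_t L³` from its slice at `s₀ = ¼`
(`DistributionalL3Mild.isMildNSSolutionOn_translate_of_distributional`), hence classical for later
times (`mild_L3_smooth_holds`), and translating back `(a, b) = (−¾, −½)`.
[cite: Chae2007, proof of Thm 1.5 (arXiv p. 8); Giga1986, Thm. 4] -/
theorem exists_classical_representative_lerayBackward (hT : 0 < T)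
    (hv : IsClassicalNSSolutionOn (Ioo 0 T) 1 0 v π) (hV : MemLp V 3 volume)
    (hVm : StronglyMeasurable V) (hq : 2 ≤ q)
    (hdev : ∀ R : ℝ, 0 < R → Tendsto (chaeLocalDeviation T z q R v V) (𝓝[<] T) (𝓝 0)) :
    ∃ (a b : ℝ) (W : ℝ → ℝ³ → ℝ³) (Pcl : ℝ → ℝ³ → ℝ), a < b ∧ b ≤ 0 ∧
      IsClassicalNSSolutionOn (Ioo a b) 1 0 W Pcl ∧
      ∀ t ∈ Ioo a b, W t =ᵐ[volume] lerayBackward (1 / 2) 0 V t := by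
  set w : ℝ → ℝ³ → ℝ³ := fun s => lerayBackward (1 / 2) 0 V (s - 1) with hw
  have hS : (0 : ℝ) < 1 / 2 := by norm_num
  have hS1 : (1 / 2 : ℝ) < 1 := by norm_num
  obtain ⟨P, hdist, hP⟩ := exists_distributional_shift hT hv hV hVm hq hdev hS hS1
  have huc : ContinuousInLpOn (Ioo 0 (1 / 2)) 3 w :=
    continuousInLpOn_lerayBackward_shift hV fun s hs => hs.2.trans hS1
  set M : ℝ≥0 := (eLpNorm V 3 volume).toNNReal with hM
  have hMeq : (M : ℝ≥0∞) = eLpNorm V 3 volume := ENNReal.coe_toNNReal hV.2.ne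
  have huM : ∀ τ ∈ Ioo (0 : ℝ) (1 / 2), eLpNorm (w τ) 3 volume ≤ M := fun τ hτ => by
    rw [hMeq, hw]
    exact (eLpNorm_lerayBackward_shift V (hτ.2.trans hS1)).le
  have hdivsl : ∀ τ ∈ Ioo (0 : ℝ) (1 / 2), IsWeaklyDivFree (w τ) := fun τ hτ =>
    isWeaklyDivFree_shift hT hv hV.1 hq hdev ⟨hτ.1, hτ.2.trans hS1⟩
  -- mild from the slice at `s₀ = 1/4`
  have hs₀ : (1 / 4 : ℝ) ∈ Ioo (0 : ℝ) (1 / 2) := ⟨by norm_num, by norm_num⟩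
  have hmild := DistributionalL3Mild.isMildNSSolutionOn_translate_of_distributional one_pos hdist
    huc huM hP hdivsl hs₀
  have hT' : (0 : ℝ) < 1 / 2 - 1 / 4 := by norm_num
  -- the hypotheses of `mild_L3_smooth`
  have hu₀ : MemLp (w (1 / 4)) 3 volume := huc.1 _ hs₀
  have hdiv₀ : IsWeaklyDivFree (w (1 / 4)) := hdivsl _ hs₀
  have hvc : ContinuousInLpOn (Ico 0 (1 / 2 - 1 / 4)) 3 (fun σ => w (σ + 1 / 4)) := by
    have h1 : ContinuousInLpOn (Ico 0 (1 / 2)) 3 w :=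
      continuousInLpOn_lerayBackward_shift hV fun s hs => hs.2.trans hS1
    exact h1.translate_Ico (by norm_num) le_rfl
  have hsm := stronglyMeasurable_uncurry_lerayBackward_shift hVm
  have hmeas : AEStronglyMeasurable (uncurry fun σ => w (σ + 1 / 4))
      (volume.restrict (Ioo 0 (1 / 2 - 1 / 4) ×ˢ univ)) := by
    have hm : Measurable fun ζ : ℝ × ℝ³ => (ζ.1 + 1 / 4, ζ.2) :=
      (measurable_fst.add_const _).prodMk measurable_snd
    have h := (hsm.comp_measurable hm).aestronglyMeasurable
      (μ := volume.restrict (Ioo 0 (1 / 2 - 1 / 4) ×ˢ univ))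
    exact h
  obtain ⟨W, Pcl, hW, hae⟩ := mild_L3_smooth_holds one_pos hT' hu₀ hdiv₀ hmild hvc hmeas
  -- translate back by `s₀ - 1 = -3/4`
  have hW' := hW.translate_back_Ioo (s := 1 / 4 - 1)
  refine ⟨1 / 4 - 1, 1 / 4 - 1 + (1 / 2 - 1 / 4), _, _, by norm_num, by norm_num, hW', fun t ht => ?_⟩
  have hσ : t - (1 / 4 - 1) ∈ Ioo 0 (1 / 2 - 1 / 4) := ⟨by linarith [ht.1], by linarith [ht.2]⟩
  have h := hae _ hσ
  have e : t - (1 / 4 - 1) + 1 / 4 - 1 = t := by ring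
  rw [e] at h
  exact h

end Chain


/-! ### The endgame on a general final interval, and `V̄ = 0` for `p = 3` -/

section EndgameThree

/-- **The endgame on a general final interval** (variant of the third companion's
`profile_ae_eq_zero_of_classical_representative`, whose proof uses the classical representative
only near one normalised time): let `V ∈ L^p(ℝ³)`, `3 ≤ p < ∞`, and suppose the backward
self-similar field `u_V = lerayBackward ½ 0 V` has a classical representative `(w, π)` (`ν > 0`,
`f = 0`) on some interval `(lo, hi)` with `lo < hi ≤ 0`: `w(t) = u_V(t)` a.e. for every
`t ∈ (lo, hi)`. Then `V = 0` a.e. (rate `a = −1/(lo + hi)`, normalised time `(lo + hi)/2`; then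
word for word the third companion: `w` is Leray's field of the smooth profile `w((lo+hi)/2)`, a
Leray profile in `L^p`, which vanishes by `necas_ruzicka_sverak_holds` / `tsai_selfsimilar_holds`).
[cite: Chae2007, proof of Thm 1.5 (arXiv p. 8)] -/
theorem profile_ae_eq_zero_of_classical_representative'
    {V : EuclideanSpace ℝ (Fin 3) → EuclideanSpace ℝ (Fin 3)} {p : ℝ≥0∞} (hp3 : 3 ≤ p)
    (hptop : p < (⊤ : ℝ≥0∞)) (hV : MemLp V p volume) {lo hi ν : ℝ} (hlohi : lo < hi) (hhi : hi ≤ 0)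
    (hν : 0 < ν) {w : ℝ → EuclideanSpace ℝ (Fin 3) → EuclideanSpace ℝ (Fin 3)}
    {π : ℝ → EuclideanSpace ℝ (Fin 3) → ℝ} (hw : IsClassicalNSSolutionOn (Ioo lo hi) ν 0 w π)
    (hae : ∀ t ∈ Ioo lo hi, w t =ᵐ[volume] lerayBackward (1 / 2) 0 V t) :
    V =ᵐ[volume] 0 := by
  -- the rate `a = -1/(lo + hi)` normalises the time `t₁ = (lo + hi)/2 < 0`
  set s₀ : ℝ := lo + hi with hs₀def
  have hs₀ : s₀ < 0 := by rw [hs₀def]; linarith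
  set a : ℝ := -s₀⁻¹ with ha
  have ha0 : 0 < a := by rw [ha]; exact neg_pos.2 (inv_lt_zero.2 hs₀)
  have ht₁ : (0 : ℝ) - (2 * a)⁻¹ = s₀ / 2 := by rw [ha]; field_simp; ring
  have ht₁mem : s₀ / 2 ∈ Ioo lo hi := ⟨by rw [hs₀def]; linarith, by rw [hs₀def]; linarith⟩
  have hint : (0 : ℝ) - (2 * a)⁻¹ ∈ interior (Ioo lo hi) := by rw [interior_Ioo, ht₁]; exact ht₁mem
  set c : ℝ := Real.sqrt (2 * a) with hc
  have hc0 : c ≠ 0 := (Real.sqrt_pos.2 (by positivity)).ne'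
  set Ua : EuclideanSpace ℝ (Fin 3) → EuclideanSpace ℝ (Fin 3) := nsRescaleData c V with hUa
  have huV : lerayBackward (1 / 2) 0 V = lerayBackward a 0 Ua := lerayBackward_half_zero_eq V ha0
  -- the smooth slice at `t₁`
  set U : EuclideanSpace ℝ (Fin 3) → EuclideanSpace ℝ (Fin 3) := w (s₀ / 2) with hU
  have hUsmooth : ContDiff ℝ ∞ U := hw.contDiff_velocity ht₁mem
  have hUae : Ua =ᵐ[volume] U := by
    have h1 := hae _ ht₁mem
    have e : lerayBackward a 0 Ua (s₀ / 2) = Ua := by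
      rw [← ht₁]; exact lerayBackward_apply_sub_inv ha0 0 Ua
    rw [huV, e] at h1
    exact h1.symm
  -- `w` IS the self-similar field of the smooth profile `U`
  have hwt : ∀ t ∈ Ioo lo hi, w t = lerayBackward a 0 U t := by
    intro t ht
    have hlt : t < 0 := ht.2.trans_le hhi
    set l : ℝ := (Real.sqrt (2 * a * (0 - t)))⁻¹ with hl
    have hl0 : l ≠ 0 := (inv_pos.2 (Real.sqrt_pos.2 (by nlinarith))).ne'
    have h1 : w t =ᵐ[volume] lerayBackward a 0 Ua t := huV ▸ hae t ht
    have h2 : lerayBackward a 0 Ua t =ᵐ[volume] lerayBackward a 0 U t := by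
      have hcomp := (Measure.quasiMeasurePreserving_smul volume hl0).ae_eq_comp hUae
      filter_upwards [hcomp] with x hx
      simp only [Function.comp_apply] at hx
      simp only [lerayBackward_apply, ← hl, hx]
    have hcw : Continuous (w t) := (hw.contDiff_velocity ht).continuous
    have hUc : Continuous U := hUsmooth.continuous
    have hcu : Continuous (lerayBackward a 0 U t) := by
      show Continuous fun x =>
        (Real.sqrt (2 * a * (0 - t)))⁻¹ • U ((Real.sqrt (2 * a * (0 - t)))⁻¹ • x)
      fun_prop
    exact (Continuous.ae_eq_iff_eq volume hcw hcu).1 (h1.trans h2)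
  have hw' : IsClassicalNSSolutionOn (Ioo lo hi) ν 0 (lerayBackward a 0 U) π :=
    { smooth_velocity := hw.smooth_velocity.congr fun q hq => by
        change lerayBackward a 0 U q.1 q.2 = w q.1 q.2
        rw [hwt q.1 (mem_prod.1 hq).1]
      smooth_pressure := hw.smooth_pressure
      momentum := fun t ht x => by
        have h1 : timeDerivWithin (Ioo lo hi) (lerayBackward a 0 U) t x =
            timeDerivWithin (Ioo lo hi) w t x := by
          simp only [timeDerivWithin]
          exact derivWithin_congr (fun s hs => by rw [hwt s hs]) (by rw [hwt t ht])
        rw [h1, ← hwt t ht]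
        exact hw.momentum t ht x
      divFree := fun t ht => by
        rw [← hwt t ht]
        exact hw.divFree t ht }
  -- Leray's reduction with the free pressure `π`
  have hprof : IsLerayProfile ν a U (π (0 - (2 * a)⁻¹)) :=
    isLerayProfile_of_isClassical_lerayBackward ha0 hUsmooth hint hw'
  -- `U ∈ L^p`
  have hUp : MemLp U p volume := (memLp_nsRescaleData hV hc0).ae_eq hUae
  -- Liouville: `U = 0`
  have hU0 : U = 0 := by
    rcases hp3.eq_or_lt with h3 | h3
    · exact necas_ruzicka_sverak_holds hν ha0 hprof (h3 ▸ hUp)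
    · exact tsai_selfsimilar_holds hν ha0 hprof h3 hptop hUp
  -- back to `V`
  have hUa0 : Ua =ᵐ[volume] 0 := hU0 ▸ hUae
  have hVc : (fun x => V (c • x)) =ᵐ[volume] 0 := by
    filter_upwards [hUa0] with x hx
    have hx' : c • V (c • x) = 0 := hx
    exact (smul_eq_zero.1 hx').resolve_left hc0
  have hcomp := (Measure.quasiMeasurePreserving_smul volume (inv_ne_zero hc0)).ae_eq_comp hVc
  filter_upwards [hcomp] with x hx
  simpa only [Function.comp_apply, smul_smul, mul_inv_cancel₀ hc0, one_smul, Pi.zero_apply] using hx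


end EndgameThree


/-! ### `V̄ = 0` for `p = 3`, and the assembly with the regularity input only for `p > 3` -/

section Three

variable {T : ℝ} {q : ℝ≥0} {v : ℝ → ℝ³ → ℝ³} {π : ℝ → ℝ³ → ℝ}

/-- **Chae 2007, Theorem 1.5, first conclusion for `p = 3`, proved**: let `(v, π)` be a classical
solution of Navier–Stokes (`ν = 1`, `f = 0`) on `ℝ³ × (0, T)`, `V̄ ∈ L³(ℝ³)`, `q ≥ 2`, and suppose
Chae's deviation tends to `0` as `t ↑ T` for every `R > 0` (the hypothesis of Theorem 1.5 in
normal form). Then `V̄ = 0` a.e. Proof: replace `V̄` by a strongly measurable representative (the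
deviation and the class only see `V̄` up to null sets, `chaeLocalDeviation_congr_ae`); the
blow-up limit then has a classical representative on a final interval
(`exists_classical_representative_lerayBackward`: very weak ⇒ distributional ⇒ mild ⇒
classical, by the tree's Kato theory), and the endgame
`profile_ae_eq_zero_of_classical_representative'` (Nečas–Růžička–Šverák) applies. In print this
is "`V̄` is a weak solution of the Leray system … by [NRŠ] `V̄ = 0`" (arXiv p. 8), the regularity
of the weak profile being implicit. [cite: Chae2007, proof of Thm 1.5 (arXiv p. 8); NecasRuzickaSverak1996, Thm 1] -/
theorem chae2007_profile_ae_eq_zero_three (hT : 0 < T)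
    (hv : IsClassicalNSSolutionOn (Ioo 0 T) 1 0 v π) (z : ℝ³) {V : ℝ³ → ℝ³}
    (hV : MemLp V 3 volume) (hq2 : 2 ≤ q)
    (hall : ∀ R : ℝ, 0 < R → Tendsto (chaeLocalDeviation T z q R v V) (𝓝[<] T) (𝓝 0)) :
    V =ᵐ[volume] 0 := by
  -- a strongly measurable representative
  set V' : ℝ³ → ℝ³ := hV.1.mk V with hV'def
  have hVV' : V =ᵐ[volume] V' := hV.1.ae_eq_mk
  have hV'm : StronglyMeasurable V' := hV.1.stronglyMeasurable_mk
  have hV' : MemLp V' 3 volume := hV.ae_eq hVV'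
  have hall' : ∀ R : ℝ, 0 < R → Tendsto (chaeLocalDeviation T z q R v V') (𝓝[<] T) (𝓝 0) := by
    intro R hR
    refine (hall R hR).congr fun t => ?_
    exact chaeLocalDeviation_congr_ae hVV' t
  obtain ⟨a, b, W, Pcl, hab, hb, hW, hae⟩ :=
    exists_classical_representative_lerayBackward hT hv hV' hV'm hq2 hall'
  have h0 : V' =ᵐ[volume] 0 :=
    profile_ae_eq_zero_of_classical_representative' (p := 3) le_rfl (by norm_num) hV' hab hb
      one_pos hW hae
  exact hVV'.trans h0

/-- **First conclusion of Theorem 1.5 with the regularity input only for `p > 3`**: `V̄ = 0`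
a.e., by `chae2007_profile_ae_eq_zero_three` when `p = 3`, and for `p > 3` as in the fourth
companion (`chae2007_profile_ae_eq_zero_of_regularityInput`: the very weak Leray profile of the
second companion, its `C²` representative from the input, and Tsai's theorem
`tsai_selfsimilar_holds`). [cite: Chae2007, proof of Thm 1.5 (arXiv p. 8)] -/
theorem chae2007_profile_ae_eq_zero_of_regularityInput_three
    (h₁ : ∀ (V : ℝ³ → ℝ³) (p : ℝ≥0), 3 < p → MemLp V (p : ℝ≥0∞) volume → IsWeaklyDivFree V →
      (∀ Φ : ℝ³ → ℝ³, FunctionSpaces.IsTestFunctionOn (⊤ : Opens ℝ³) Φ → VectorCalculus.IsDivFree Φ →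
        ∫ w, (⟪V w, (Δ Φ) w⟫ + ⟪V w, Φ w⟫ + 1 / 2 * ⟪V w, fderiv ℝ Φ w w⟫ +
          ⟪V w, fderiv ℝ Φ w (V w)⟫) = 0) →
      ∃ (U : ℝ³ → ℝ³) (P : ℝ³ → ℝ), IsLerayProfile 1 (1 / 2) U P ∧ V =ᵐ[volume] U)
    (hT : 0 < T) {p : ℝ≥0} (hp : 3 ≤ p) (hv : IsClassicalNSSolutionOn (Ioo 0 T) 1 0 v π)
    (z : ℝ³) {V : ℝ³ → ℝ³} (hV : MemLp V (p : ℝ≥0∞) volume) (hq2 : 2 ≤ q)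
    (hall : ∀ R : ℝ, 0 < R → Tendsto (chaeLocalDeviation T z q R v V) (𝓝[<] T) (𝓝 0)) :
    V =ᵐ[volume] 0 := by
  rcases hp.eq_or_lt with h3 | h3
  · have hV3 : MemLp V 3 volume := by
      have : ((p : ℝ≥0) : ℝ≥0∞) = 3 := by rw [← h3]; norm_num
      rwa [this] at hV
    exact chae2007_profile_ae_eq_zero_three hT hv z hV3 hq2 hall
  · have hlim : ∀ R : ℝ, 0 < R → Tendsto (fun l : ℝ => ⨆ s ∈ Ioo (-1 : ℝ) 0, eLpNorm
        (fun y => nsRescale l (fun τ x => v (T + τ) (z + x)) s y - lerayBackward (1 / 2) 0 V s y)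
        (q : ℝ≥0∞) (volume.restrict (ball 0 R))) (𝓝[>] 0) (𝓝 0) := fun R hR =>
      tendsto_iSup_nsRescale_sub_lerayBackward (hall R hR)
    have hVm : AEStronglyMeasurable V volume := hV.1
    have hdiv := isWeaklyDivFree_profile_of_tendsto hT hv hq2 hVm hlim
    have hleray : ∀ Φ : ℝ³ → ℝ³, FunctionSpaces.IsTestFunctionOn (⊤ : Opens ℝ³) Φ →
        VectorCalculus.IsDivFree Φ →
        ∫ w, (⟪V w, (Δ Φ) w⟫ + ⟪V w, Φ w⟫ + 1 / 2 * ⟪V w, fderiv ℝ Φ w w⟫ +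
          ⟪V w, fderiv ℝ Φ w (V w)⟫) = 0 := fun Φ hΦ hΦdiv =>
      lerayVeryWeak_profile_of_tendsto hT hv hq2 hVm hlim hΦ hΦdiv
    obtain ⟨U, P, hprof, hVU⟩ := h₁ V p h3 hV hdiv hleray
    have hU : MemLp U (p : ℝ≥0∞) volume := hV.ae_eq hVU
    have hU0 : U = 0 :=
      tsai_selfsimilar_holds one_pos (by norm_num) hprof (by exact_mod_cast h3) ENNReal.coe_lt_top hU
    rw [← hU0]
    exact hVU

/-- **Chae 2007, Theorem 1.5, from the regularity of very weak Leray profiles in `L^p`, `p > 3`,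
and local Leray theory up to the blow-up time.** The named fact
`chae2007_asymptoticallySelfSimilar_local` follows from

* `h₁` — **regularity of very weak Leray profiles for `p > 3` only**: a weakly divergence-free
  `V ∈ L^p(ℝ³)`, `3 < p < ∞`, solving Leray's system
  `ΔV − ½V − ½(y·∇)V − (V·∇)V − ∇P = 0` against divergence-free test fields agrees a.e. with a
  `C²` Leray profile (the case `p = 3` is now a theorem, `chae2007_profile_ae_eq_zero_three`);
* `h₂` — **a suitable representative up to the final time** (as in the sixth companion): for
  the classical solution `v ∈ C([0,T); L^p)` and every `z`, some pair `(u, P)` of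
  Albritton–Barker's class in a parabolic ball `Q((T, z), ρ)`, `ρ² ≤ T`, with `u = v` a.e. there
  (local Leray theory: cf. the tree's facts `localEnergySolution_exists_local_of_memE2`,
  `localEnergySolution_extension_of_memE2`, `local_leray_weak_strong_uniqueness`).

Proof: `V̄ = 0` (`chae2007_profile_ae_eq_zero_of_regularityInput_three`); the deviation from the
zero profile then tends to `0` for every `R` (`chaeLocalDeviation_congr_ae`), the representative of
`h₂` inherits the scaled `L^∞_t L^q_x` smallness
(`exists_ae_eLpNorm_le_of_tendsto_chaeLocalDeviation_zero`), `C + D` is small at one scale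
(`exists_cknC_add_cknD_lt_of_ae_eLpNorm_small_of_two_le`, every `q ≥ 2`), and the ε-regularity
endgame `chae_exists_eps_holder_of_suitableInBall` gives the Hölder conclusion.
[cite: Chae2007, Thm 1.5 and its proof (arXiv pp. 7–8)] -/
theorem chae2007_asymptoticallySelfSimilar_local_of_inputs_three
    (h₁ : ∀ (V : ℝ³ → ℝ³) (p : ℝ≥0), 3 < p → MemLp V (p : ℝ≥0∞) volume → IsWeaklyDivFree V →
      (∀ Φ : ℝ³ → ℝ³, FunctionSpaces.IsTestFunctionOn (⊤ : Opens ℝ³) Φ → VectorCalculus.IsDivFree Φ →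
        ∫ w, (⟪V w, (Δ Φ) w⟫ + ⟪V w, Φ w⟫ + 1 / 2 * ⟪V w, fderiv ℝ Φ w w⟫ +
          ⟪V w, fderiv ℝ Φ w (V w)⟫) = 0) →
      ∃ (U : ℝ³ → ℝ³) (P : ℝ³ → ℝ), IsLerayProfile 1 (1 / 2) U P ∧ V =ᵐ[volume] U)
    (h₂ : ∀ ⦃T : ℝ⦄, 0 < T → ∀ ⦃p : ℝ≥0⦄, 3 ≤ p → ∀ ⦃v : ℝ → ℝ³ → ℝ³⦄ ⦃π : ℝ → ℝ³ → ℝ⦄,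
      IsClassicalNSSolutionOn (Ioo 0 T) 1 0 v π → ContinuousInLpOn (Ico 0 T) p v →
      ∀ z : ℝ³, ∃ ρ : ℝ, 0 < ρ ∧ ρ ^ 2 ≤ T ∧ ∃ (u : ℝ → ℝ³ → ℝ³) (P : ℝ → ℝ³ → ℝ),
        IsSuitableWeakSolutionInBall ρ (T, z) u P ∧
        uncurry u =ᵐ[volume.restrict (parabolicCylinder ρ (T, z))] uncurry v) :
    chae2007_asymptoticallySelfSimilar_local := by
  intro T hT p hp v π hv hvc z V hV q hq
  obtain ⟨hq2, hall⟩ := forall_tendsto_chaeLocalDeviation_of_hyp hq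
  have hV0 : V =ᵐ[volume] 0 :=
    chae2007_profile_ae_eq_zero_of_regularityInput_three h₁ hT hp hv z hV hq2 hall
  refine ⟨hV0, ?_⟩
  have hall0 : ∀ R : ℝ, 0 < R → Tendsto (chaeLocalDeviation T z q R v 0) (𝓝[<] T) (𝓝 0) := by
    intro R hR
    refine (hall R hR).congr fun t => ?_
    exact chaeLocalDeviation_congr_ae hV0 t
  obtain ⟨ε₀, hε₀, H⟩ := chae_exists_eps_holder_of_suitableInBall hv z
  obtain ⟨ρ, hρ, hρT, u, P, hIB, huv⟩ := h₂ hT hp hv hvc z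
  have hS : ∀ η : ℝ, 0 < η → ∃ r₁ : ℝ, 0 < r₁ ∧ r₁ ≤ ρ ∧ ∀ r : ℝ, 0 < r → r ≤ r₁ →
      ∀ᵐ t ∂(volume.restrict (Ioo ((T, z).1 - r ^ 2) (T, z).1)),
        eLpNorm (u t) (q : ℝ≥0∞) (volume.restrict (ball (T, z).2 r)) *
          ENNReal.ofReal (r ^ (((q : ℝ) - 3) / q)) ≤ ENNReal.ofReal η := fun η hη =>
    exists_ae_eLpNorm_le_of_tendsto_chaeLocalDeviation_zero hρ (hall0 1 one_pos) huv hη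
  obtain ⟨r₀, hr₀, hr₀ρ, hsmall⟩ :=
    exists_cknC_add_cknD_lt_of_ae_eLpNorm_small_of_two_le hIB hq2 hS hε₀
  exact H r₀ hr₀ (by nlinarith) u P (hIB.of_le_radius hr₀ hr₀ρ)
    (ae_restrict_of_ae_restrict_of_subset (parabolicCylinder_mono hr₀.le hr₀ρ (T, z)) huv) hsmall

end Three

end Literature.Analysis.FluidPDE

end
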